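import Mathlib
import Literature.Analysis.FluidPDE.Tao2016AveragedNS.ShiftSetCascadeFlows
import Summits.NavierStokesRegularity.NavierStokesRegularity.Theorems.TaoLadderRungTwoFlatMirrorTableDefs
import Summits.NavierStokesRegularity.NavierStokesRegularity.Theorems.TaoLadderRungTwoFlatMirrorField
import Summits.NavierStokesRegularity.NavierStokesRegularity.Theorems.TaoLadderRungTwoFlatEnergyFluxPointwise
import Summits.NavierStokesRegularity.NavierStokesRegularity.Theorems.TaoLadderRungTwoFlatCoMovingEnergy
import HarnessLib

/-!
# Tao ladder, rung 2♭ — the INTERFACE STENCIL: how the zone behind an edge forces the zone ahead of it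
  (junk race L8b-2, pointwise part) (helper for item stmt-NavierStokesRegularity-22987 `FlatGapCertificatesV2`,
  crux K_A♭ of route TaoLadderRungTwoFlat; cell harvest/h2-tao-ladder, p1 g21; LADDER §49.5 (b))

theory-1 g37 (JUNK-RACE-49 §49.5): the loop between the CORE ZONE (shells `≥ e+1`, controlled by the hop
contraction in a gauge) and the BEHIND ZONE (shells `≤ e`, controlled by the co-moving energy `V`) closes only in
LOCALISED form — the behind zone may enter the core-zone estimate solely through the lattice stencil at the
interface. For the graded mirror lattice `quadTermOn S♭ ε₀ (mirrorTable ε ε)` (carrier `0 = a`, bond `1 = v`,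
clocks `c_n = (1+ε₀)^{5n/2}`) this stencil is ONE monomial group:

* `quadTermOn_eq_of_eqOn_core` — if two families agree at every site of shells `≥ e+1`, their fields agree at every
  site of shells `≥ e+2` (both species) …
* `quadTermOn_bond_eq_of_eqOn_core` — … and at the bond of shell `e+1`;
* `quadTermOn_carrier_interface` — at the carrier of shell `e+1` they differ by
  `c_e·(v_e − v'_e)·(v_e + v'_e + ε·a_{e+1})` (only the bond value AT the edge shell `e` enters);
* `abs_interface_forcing_le` — with `Y = W + u` (true solution) and `Y' =` its behind-truncation (`= W` on shells
  `≤ e`): `|Q₀,ₑ₊₁(Y) − Q₀,ₑ₊₁(Y')| ≤ c_e·|q_e|·(2|V_e| + |q_e| + ε(|A_{e+1}| + |p_{e+1}|))` — FIRST ORDER in the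
  template amplitude at the edge `|V_e| ≤ η̂` and in the core deviation at its back edge `|p_{e+1}| ≤ r_e`, times the
  behind deviation `|q_e| ≤ √(2e^{θ(n_e−e)}V)` (`abs_behind_le_of_coMovingEnergyOn`): theory-1's
  `κ_t ∝ c̄(1+ε)(η̂(d₁−1) + r_e)`, the small off-diagonal entry of the two-zone loop (`…Theorems.TwoZoneLoop`).

HONEST FRAMING: finite algebra about a MODEL lattice nonlinearity (Tao 2016 §4 vocabulary on `S♭`), kernel-checked;
nothing certified about any orbit; nothing about the Navier–Stokes equations.
-/

noncomputable section

-- the sub-problem namespace repeats the summit name by design (D-0017)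
set_option linter.dupNamespace false

namespace Summit.NavierStokesRegularity.NavierStokesRegularity.Theorems

open Literature.Analysis.FluidPDE Literature.Analysis.FluidPDE.TaoCascade

namespace MirrorPulse

/-- **No coupling two shells up.** If `Y` and `Y'` agree at all sites of shells `≥ e+1` (at time `t`), then
`Qᵢ,ₙ(Y) = Qᵢ,ₙ(Y')` for every species `i` and every shell `n ≥ e+2`: the mirror field at shell `n` reads shells
`n−1, n, n+1` only. [cite: Tao2016AveragedNS, §4 (4.8) (nearest-neighbour triads); route TaoLadderRungTwoFlat, L8b-2 (LADDER §49.5 (b))] -/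
theorem quadTermOn_eq_of_eqOn_core (ε₀ ε : ℝ) {Y Y' : Fin 2 → ℤ → ℝ → ℝ} {e : ℤ} {t : ℝ}
    (hYY : ∀ i, ∀ k, e + 1 ≤ k → Y i k t = Y' i k t) (i : Fin 2) {n : ℤ} (hn : e + 2 ≤ n) :
    quadTermOn shiftSetFlat ε₀ (mirrorTable ε ε) Y i n t = quadTermOn shiftSetFlat ε₀ (mirrorTable ε ε) Y' i n t := by
  fin_cases i
  · simp only [Fin.zero_eta, Fin.isValue, MirrorField.quadTermOn_mirrorTable_carrier]
    rw [hYY 1 (n - 1) (by omega), hYY 0 n (by omega), hYY 1 n (by omega)]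
  · simp only [Fin.mk_one, Fin.isValue, MirrorField.quadTermOn_mirrorTable_bond]
    rw [hYY 0 n (by omega), hYY 1 n (by omega), hYY 0 (n + 1) (by omega)]

/-- **No coupling into the bond at the interface shell.** Under the same agreement, `Q₁,ₑ₊₁(Y) = Q₁,ₑ₊₁(Y')`:
the bond equation of shell `e+1` reads shells `e+1, e+2` only. [cite: Tao2016AveragedNS, §4 (4.8); route TaoLadderRungTwoFlat, L8b-2 (LADDER §49.5 (b))] -/
theorem quadTermOn_bond_eq_of_eqOn_core (ε₀ ε : ℝ) {Y Y' : Fin 2 → ℤ → ℝ → ℝ} {e : ℤ} {t : ℝ}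
    (hYY : ∀ i, ∀ k, e + 1 ≤ k → Y i k t = Y' i k t) :
    quadTermOn shiftSetFlat ε₀ (mirrorTable ε ε) Y 1 (e + 1) t
      = quadTermOn shiftSetFlat ε₀ (mirrorTable ε ε) Y' 1 (e + 1) t := by
  simp only [Fin.isValue, MirrorField.quadTermOn_mirrorTable_bond]
  rw [hYY 0 (e + 1) (by omega), hYY 1 (e + 1) (by omega), hYY 0 (e + 1 + 1) (by omega)]

/-- **THE INTERFACE MONOMIAL.** Under the same agreement, the carrier equation of shell `e+1` differs by
`Q₀,ₑ₊₁(Y) − Q₀,ₑ₊₁(Y') = c_e·(v_e − v'_e)·(v_e + v'_e + ε·a_{e+1})` (`v = Y 1`, `a = Y 0`): the ONLY channel from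
the shells `≤ e` into the shells `≥ e+1` is the bond value at the edge shell `e`, through the Toda term `c_e v_e²` and
the mirror term `ε c_e a_{e+1} v_e`. [cite: Tao2016AveragedNS, §4 (4.8); route TaoLadderRungTwoFlat, L8b-2 (LADDER §49.5 (b))] -/
theorem quadTermOn_carrier_interface (ε₀ ε : ℝ) {Y Y' : Fin 2 → ℤ → ℝ → ℝ} {e : ℤ} {t : ℝ}
    (hYY : ∀ i, ∀ k, e + 1 ≤ k → Y i k t = Y' i k t) :
    quadTermOn shiftSetFlat ε₀ (mirrorTable ε ε) Y 0 (e + 1) t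
        - quadTermOn shiftSetFlat ε₀ (mirrorTable ε ε) Y' 0 (e + 1) t
      = clock ε₀ e * (Y 1 e t - Y' 1 e t) * (Y 1 e t + Y' 1 e t + ε * Y 0 (e + 1) t) := by
  simp only [Fin.isValue, MirrorField.quadTermOn_mirrorTable_carrier, clock, add_sub_cancel_right]
  rw [hYY 0 (e + 1) (by omega), hYY 1 (e + 1) (by omega)]
  have hexp : ((5 : ℝ) * (((e + 1 : ℤ) : ℝ) - 1) / 2) = (5 : ℝ) * (e : ℝ) / 2 := by push_cast; ring
  rw [hexp]
  ring

/-- **INTERFACE FORCING BOUND.** Let `Y = W + u` and let `Y'` agree with `Y` on shells `≥ e+1` and with `W` at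
the bond of shell `e` (the behind-truncated comparison family). Then
`|Q₀,ₑ₊₁(Y) − Q₀,ₑ₊₁(Y')| ≤ c_e·|q_e|·(2|V_e| + |q_e| + ε·(|A_{e+1}| + |p_{e+1}|))`
(`W = (A,V)`, `u = (p,q)`, `0 ≤ ε`, `−1 ≤ ε₀`): first order in the template amplitude AT the edge and in the core
deviation at its back edge, times the behind deviation at the edge — theory-1's `κ_t`.
[cite: Tao2016AveragedNS, §4 (4.8); route TaoLadderRungTwoFlat, L8b-2 (LADDER §49.5 (b))] -/
theorem abs_interface_forcing_le {ε₀ ε : ℝ} (hε : 0 ≤ ε) (hε₀ : -1 ≤ ε₀) {W u Y' : Fin 2 → ℤ → ℝ → ℝ}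
    {e : ℤ} {t : ℝ} (hYY : ∀ i, ∀ k, e + 1 ≤ k → (W + u) i k t = Y' i k t) (hY'e : Y' 1 e t = W 1 e t) :
    |quadTermOn shiftSetFlat ε₀ (mirrorTable ε ε) (W + u) 0 (e + 1) t
        - quadTermOn shiftSetFlat ε₀ (mirrorTable ε ε) Y' 0 (e + 1) t|
      ≤ clock ε₀ e * |u 1 e t| *
          (2 * |W 1 e t| + |u 1 e t| + ε * (|W 0 (e + 1) t| + |u 0 (e + 1) t|)) := by
  rw [quadTermOn_carrier_interface ε₀ ε hYY, hY'e]
  simp only [Pi.add_apply, add_sub_cancel_left]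
  have hc : 0 ≤ clock ε₀ e := by unfold clock; exact Real.rpow_nonneg (by linarith) _
  rw [abs_mul, abs_mul, abs_of_nonneg hc]
  have h3 : |W 1 e t + u 1 e t + W 1 e t + ε * (W 0 (e + 1) t + u 0 (e + 1) t)|
      ≤ 2 * |W 1 e t| + |u 1 e t| + ε * (|W 0 (e + 1) t| + |u 0 (e + 1) t|) := by
    calc |W 1 e t + u 1 e t + W 1 e t + ε * (W 0 (e + 1) t + u 0 (e + 1) t)|
        ≤ |W 1 e t + u 1 e t + W 1 e t| + |ε * (W 0 (e + 1) t + u 0 (e + 1) t)| := abs_add_le _ _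
      _ ≤ (|W 1 e t| + |u 1 e t| + |W 1 e t|) + ε * (|W 0 (e + 1) t| + |u 0 (e + 1) t|) := by
          gcongr
          · exact abs_add_three _ _ _
          · rw [abs_mul, abs_of_nonneg hε]
            exact mul_le_mul_of_nonneg_left (abs_add_le _ _) hε
      _ = 2 * |W 1 e t| + |u 1 e t| + ε * (|W 0 (e + 1) t| + |u 0 (e + 1) t|) := by ring
  exact mul_le_mul_of_nonneg_left h3 (mul_nonneg hc (abs_nonneg _))

/-- **The behind deviation at the edge is controlled by the co-moving energy**: for `e ∈ s`,
`|uᵢ,ₑ| ≤ √(2·e^{θ(n_e − e)}·V_s)` (from `sq_le_exp_mul_coMovingEnergyOn`). With `e ≤ n_e < e+1` the factor is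
`≤ e^{θ}`. [cite: Tao2016AveragedNS, §4 (4.3); route TaoLadderRungTwoFlat, L8b-2 (LADDER §49.5 (b))] -/
theorem abs_behind_le_of_coMovingEnergyOn (s : Finset ℤ) (θ ne : ℝ) (u : Fin 2 → ℤ → ℝ → ℝ) (t : ℝ)
    {e : ℤ} (he : e ∈ s) (i : Fin 2) :
    |u i e t| ≤ Real.sqrt (2 * (Real.exp (θ * (ne - (e : ℝ))) * coMovingEnergyOn s θ ne u t)) := by
  have h := sq_le_exp_mul_coMovingEnergyOn s θ ne u t he i
  have h2 : u i e t ^ 2 ≤ 2 * (Real.exp (θ * (ne - (e : ℝ))) * coMovingEnergyOn s θ ne u t) := by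
    linarith
  exact Real.abs_le_sqrt h2

end MirrorPulse

end Summit.NavierStokesRegularity.NavierStokesRegularity.Theorems

end
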